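import Summits.ValiantsHypothesis.ValiantsHypothesis.Theorems.LacunarySymmetroidMatrixDescartesCensusWindowN

/-!
# `MatrixDescartes` census — SHARP WINDOWS: every killed window of a Descartes-sharp fewnomial is Descartes-sharp

HONEST FRAMING.  Object-search cell `pub-symmetroid`, route crux `Theses.LacunarySymmetroid.MatrixDescartes`
(ledger item stmt-ValiantsHypothesis-18050).  ONE elementary theorem about an arbitrary TERM-SHARP real fewnomial
`f = Σ_{t<n} c_t X^{e_t}` (`n − 1` distinct positive roots), the kernel anchor of the seat's WINDOW-4 METHOD PROPOSAL
(HOME/pub-symmetroid-engine-6/WINDOW4-g17.md): killing the exponents outside ANY window of `w` consecutive terms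
(`[i, i+w)`) by Euler twists — the tree's twisted Rolle, one root per kill — leaves the window polynomial
`Q = Σ_{t∈[i,i+w)} c_t P_t X^{e_t}`, `P_t = ∏_{u<n, u∉[i,i+w)} (e_t − e_u)`, with at least `w − 1` DISTINCT positive roots
(`card_posRoots_window_ge`): `Q` is itself Descartes-sharp.  For `w = 3` this is the tree's Newton cone C25 (trinomial
lemma); for `w = 4` it says the cell's two adjacent C25 slacks `(u_j, u_{j+1})` of a hypothetical twenty lie in the
three-positive-root region of an alternating 4-nomial — a region STRICTLY inside the Newton wedge `{u, v ≥ 0}` (the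
4-nomial discriminant test; the region itself is not typed here).  A NECESSARY condition on hypothetical twenties;
no bound on `ζ_sym`, nothing on `DoorA26`/`DoorA34` (OPEN), the crux, or `VP ≠ VNP`.

[folklore] Rolle (twisted), iterated over a finite kill set.
-/

-- `Summit.ValiantsHypothesis.ValiantsHypothesis.…` repeats a component by the D-0017 layout
-- (single-conjunct summit), which the `dupNamespace` linter flags; the name is mandated.
set_option linter.dupNamespace false

namespace Summit.ValiantsHypothesis.ValiantsHypothesis.Theorems.LacunarySymmetroidMatrixDescartes.Census

open Polynomial Finset
open scoped BigOperators Polynomial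

/-- **Iterated twisted Rolle on a range-indexed fewnomial (distinct roots).**  Killing the exponents `e u`, `u ∈ U`,
turns `Σ_{t<n} c_t X^{e_t}` into `Σ_{t<n} c_t (∏_{u∈U} (e_t − e_u)) X^{e_t}` and loses at most `#U` distinct positive
roots (the tree's `card_posRoots_le_card_posRoots_twists` is the `Fin`-indexed form). [folklore] -/
theorem card_posRoots_le_card_posRoots_twists_rsum (n : ℕ) (e : ℕ → ℕ) (c : ℕ → ℝ) (U : Finset ℕ) :
    ((∑ t ∈ range n, C (c t) * X ^ (e t) : ℝ[X]).roots.toFinset.filter (fun x => 0 < x)).card ≤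
      ((∑ t ∈ range n, C (c t * ∏ u ∈ U, ((e t : ℝ) - e u)) * X ^ (e t) : ℝ[X]).roots.toFinset.filter
        (fun x => 0 < x)).card + U.card := by
  classical
  induction U using Finset.induction_on with
  | empty => simp
  | insert u U hu ih =>
    rw [Finset.card_insert_of_notMem hu]
    have step := card_posRoots_le_card_posRoots_twist_succ
      (∑ t ∈ range n, C (c t * ∏ u' ∈ U, ((e t : ℝ) - e u')) * X ^ (e t) : ℝ[X]) (e u)
    rw [twist_rsum] at step
    have hsum : (∑ t ∈ range n, C (c t * (∏ u' ∈ U, ((e t : ℝ) - e u')) * ((e t : ℝ) - e u)) * X ^ (e t) : ℝ[X])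
        = ∑ t ∈ range n, C (c t * ∏ u' ∈ insert u U, ((e t : ℝ) - e u')) * X ^ (e t) := by
      refine Finset.sum_congr rfl fun t _ => ?_
      rw [Finset.prod_insert hu]
      ring_nf
    rw [hsum] at step
    omega

/-- The killed fewnomial equals its window part: terms `t` outside `[i, i+w)` carry the factor `e_t − e_t = 0`.
[folklore] -/
theorem rsum_kill_eq_window (n w i : ℕ) (hiw : i + w ≤ n) (e : ℕ → ℕ) (c : ℕ → ℝ) :
    (∑ t ∈ range n, C (c t * ∏ u ∈ (range n).filter (fun u => u < i ∨ i + w ≤ u), ((e t : ℝ) - e u)) * X ^ (e t)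
        : ℝ[X])
      = ∑ t ∈ Ico i (i + w), C (c t * ∏ u ∈ (range n).filter (fun u => u < i ∨ i + w ≤ u), ((e t : ℝ) - e u))
          * X ^ (e t) := by
  classical
  symm
  refine Finset.sum_subset (fun t ht => ?_) (fun t ht hnot => ?_)
  · rw [Finset.mem_Ico] at ht
    exact Finset.mem_range.mpr (by omega)
  · have htU : t ∈ (range n).filter (fun u => u < i ∨ i + w ≤ u) := by
      rw [Finset.mem_filter]
      refine ⟨ht, ?_⟩
      rw [Finset.mem_Ico] at hnot
      rw [Finset.mem_range] at ht
      omega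
    rw [Finset.prod_eq_zero htU (sub_self _), mul_zero, map_zero, zero_mul]

/-- **SHARP WINDOWS.**  Let `f = Σ_{t<n} c_t X^{e_t}` have at least `n − 1` DISTINCT positive roots (term-sharp; e.g.
the determinant of a hypothetical `(2,6)` twenty on its 21 pair sums) and let `[i, i+w)` be a window of `w ≥ 1`
consecutive indices (`i + w ≤ n`).  Then the window polynomial `Q = Σ_{t∈[i,i+w)} c_t P_t X^{e_t}`,
`P_t = ∏_{u<n, u∉[i,i+w)} (e_t − e_u)`, has at least `w − 1` DISTINCT positive roots — it is Descartes-sharp as a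
`w`-nomial.  (`w = 3`: the Newton cone C25; `w = 4`: the pair of adjacent C25 slacks lies in the exact
three-root region of an alternating 4-nomial, the WINDOW-4 test of WINDOW4-g17.md.) [folklore] -/
theorem card_posRoots_window_ge {n w i : ℕ} (hw : 1 ≤ w) (hiw : i + w ≤ n) (e : ℕ → ℕ) (c : ℕ → ℝ)
    (hZ : n - 1 ≤ ((∑ t ∈ range n, C (c t) * X ^ (e t) : ℝ[X]).roots.toFinset.filter (fun x => 0 < x)).card) :
    w - 1 ≤ ((∑ t ∈ Ico i (i + w),
        C (c t * ∏ u ∈ (range n).filter (fun u => u < i ∨ i + w ≤ u), ((e t : ℝ) - e u)) * X ^ (e t)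
          : ℝ[X]).roots.toFinset.filter (fun x => 0 < x)).card := by
  classical
  have hUcard : ((range n).filter (fun u => u < i ∨ i + w ≤ u)).card = n - w := by
    have hsplit : (range n).filter (fun u => u < i ∨ i + w ≤ u) = range i ∪ Ico (i + w) n := by
      ext u
      simp only [Finset.mem_filter, Finset.mem_range, Finset.mem_union, Finset.mem_Ico]
      omega
    rw [hsplit, Finset.card_union_of_disjoint, Finset.card_range, Nat.card_Ico]
    · omega
    · rw [Finset.disjoint_left]
      intro u hu1 hu2
      rw [Finset.mem_range] at hu1
      rw [Finset.mem_Ico] at hu2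
      omega
  have hkill := card_posRoots_le_card_posRoots_twists_rsum n e c ((range n).filter (fun u => u < i ∨ i + w ≤ u))
  rw [hUcard, rsum_kill_eq_window n w i hiw e c] at hkill
  omega

end Summit.ValiantsHypothesis.ValiantsHypothesis.Theorems.LacunarySymmetroidMatrixDescartes.Census
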